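import Literature.Analysis.FluidPDE.GIPRemainderSliceEstimates
import Literature.Analysis.FluidPDE.GIPRemainderEnergyIdentity
import Literature.Analysis.FluidPDE.GIPPressureSwap
import HarnessLib

/-!
# The window energy inequality of the caloric remainder of a Kato solution

Analysis/FluidPDE support file (theorems only) on the discharge path of
`Literature.Analysis.FluidPDE.GIP2003_L3_stability` (Gallagher–Iftimie–Planchon 2003, Thm. 0.1 (i)
= Thm. 2.1 in `L³`): the energy inequality on a time window `[a, b]` for the caloric remainder
`v = u - e^{νtΔ}u₀` of a Kato solution whose free part is small in `L³` on the window,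

  `‖v(b)‖₂² + ν ∫_a^b ‖Dv‖₂² ≤ ‖v(a)‖₂² + (4/ν) ∫_a^b ‖e^{νtΔ}u₀‖₄⁴`

(GIP 2003, proof of Thm. 2.1, (8) and the display after Gronwall, p. 1397, with the caloric
background absorbed instead of the small solution; Calderón 1990, §1; Lemarié-Rieusset 2016,
proof of Thm. 14.7, p. 516). This first part assembles the slice bound: at a fixed time, the
right-hand side of the cut-off identity (`GIP2003.remainder_local_energy_identity` with
`φ = χ_R²`) is `≤ -ν X + (4/ν)∫χ_R²|e|⁴ + O(1/R)` (`GIP2003.slice_rhs_le`).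

## References

* I. Gallagher, D. Iftimie, F. Planchon, Ann. Inst. Fourier 53 (2003), proof of Thm. 2.1,
  (8) and p. 1397. [GallagherIftimiePlanchon2003]
* P. G. Lemarié-Rieusset, *The Navier–Stokes Problem in the 21st Century*, CRC Press 2016,
  proof of Thm. 14.7, p. 516. [LemarieRieusset2016]
-/

noncomputable section

open MeasureTheory TopologicalSpace Set Function Filter Metric InnerProductSpace
open _root_.Topology
open scoped ENNReal NNReal RealInnerProductSpace Laplacian

namespace Literature.Analysis.FluidPDE

namespace GIP2003

section Slice

variable {E : Type*} [NormedAddCommGroup E] [InnerProductSpace ℝ E] [FiniteDimensional ℝ E]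
  [MeasurableSpace E] [BorelSpace E]

/-- Products of three `L³` norms below a common bound `Λ`. [folklore] -/
theorem toReal_mul_mul_le_cube {a b c : ℝ≥0∞} {Λ : ℝ} (hΛ : 0 ≤ Λ) (ha : a.toReal ≤ Λ)
    (hb : b.toReal ≤ Λ) (hc : c.toReal ≤ Λ) : (a * b * c).toReal ≤ Λ ^ 3 := by
  rw [ENNReal.toReal_mul, ENNReal.toReal_mul]
  calc a.toReal * b.toReal * c.toReal ≤ Λ * Λ * Λ :=
        mul_le_mul (mul_le_mul ha hb ENNReal.toReal_nonneg hΛ) hc ENNReal.toReal_nonneg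
          (mul_nonneg hΛ hΛ)
    _ = Λ ^ 3 := by ring

/-- **The slice bound.** At a fixed time let `V ∈ C¹ ∩ L³` be divergence free, `e ∈ C¹ ∩ L³ ∩ L⁴`
divergence free with `2√2 K ‖e‖₃ ≤ ν/4` (`K` the Gagliardo–Nirenberg–Sobolev constant), `w = V + e`,
`R ≥ 1`, `‖Dχ_R‖ ≤ C₁/R`, all `L³` norms `≤ Λ`, and let `P` (the pressure pairing) satisfy
`|P| ≤ P₀`. Then the right-hand side of the cut-off energy identity with `φ = χ_R²`,
`∫|V|²⟪w,∇φ⟫ - 2ν∫⟪DV(∇φ),V⟫ - 2ν∫φ|DV|² + 2P - 2∫φ⟪V, De(w)⟫`, is at most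
`-ν X + (4/ν)∫|e|⁴ + (10C₁Λ³ + 32νC₁²V_EΛ² + (16/ν)K²C₁²V_EΛ⁴)/R + 2P₀`, `X = ∫χ_R²|DV|²_F`,
`V_E = |B̄(0,1)|^{1/3}` (GIP 2003, proof of Thm. 2.1, (8)/p. 1397: absorption of the coupling by
smallness of the background, Sobolev; the remaining terms are cutoff errors).
[cite: GallagherIftimiePlanchon2003, Thm. 2.1 (proof, (8), p. 1397)] -/
theorem slice_rhs_le (hE : Module.finrank ℝ E = 3) {V e : E → E} (hV1 : ContDiff ℝ 1 V)
    (hV3 : MemLp V 3 volume) (he1 : ContDiff ℝ 1 e) (he3 : MemLp e 3 volume) (he4 : MemLp e 4 volume)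
    (hdivV : ∀ x, VectorCalculus.divergence V x = 0) (hdive : ∀ x, VectorCalculus.divergence e x = 0)
    {R C₁ ν Λ P P₀ : ℝ} (hR : 1 ≤ R) (hC₁ : ∀ x : E, ‖fderiv ℝ (cutoff R) x‖ ≤ C₁ / R) (hν : 0 < ν)
    (hΛ : 0 ≤ Λ) (hΛV : (eLpNorm V 3 volume).toReal ≤ Λ) (hΛe : (eLpNorm e 3 volume).toReal ≤ Λ)
    (hΛw : (eLpNorm (fun x => V x + e x) 3 volume).toReal ≤ Λ)
    (hsmall : 2 * Real.sqrt 2 * (eLpNormLESNormFDerivOfEqInnerConst (volume : Measure E) 2 : ℝ) *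
      (eLpNorm e 3 volume).toReal ≤ ν / 4)
    (hP : |P| ≤ P₀) :
    (∫ x, ‖V x‖ ^ 2 * ⟪V x + e x, gradient (fun y : E => cutoff R y ^ 2) x⟫) -
        2 * ν * (∫ x, ⟪fderiv ℝ V x (gradient (fun y : E => cutoff R y ^ 2) x), V x⟫) -
        2 * ν * (∫ x, cutoff R x ^ 2 * frobeniusNormSq (fderiv ℝ V x)) + 2 * P -
        2 * ∫ x, cutoff R x ^ 2 * ⟪V x, fderiv ℝ e x (V x + e x)⟫ ≤
      -ν * (∫ x, cutoff R x ^ 2 * frobeniusNormSq (fderiv ℝ V x)) + 4 / ν * (∫ x, ‖e x‖ ^ 4) +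
        (10 * C₁ * Λ ^ 3 + 32 * ν * C₁ ^ 2 * ((volume (closedBall (0 : E) 1)) ^ (1 / 3 : ℝ)).toReal * Λ ^ 2 +
          16 / ν * (eLpNormLESNormFDerivOfEqInnerConst (volume : Measure E) 2 : ℝ) ^ 2 * C₁ ^ 2 *
            ((volume (closedBall (0 : E) 1)) ^ (1 / 3 : ℝ)).toReal * Λ ^ 4) / R + 2 * P₀ := by
  have hR0 : 0 < R := one_pos.trans_le hR
  have hC₁0 : 0 ≤ C₁ := by
    have h := le_trans (norm_nonneg _) (hC₁ 0)
    rwa [le_div_iff₀ hR0, zero_mul] at h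
  set X : ℝ := ∫ x, cutoff R x ^ 2 * frobeniusNormSq (fderiv ℝ V x) with hX
  set VE : ℝ := ((volume (closedBall (0 : E) 1)) ^ (1 / 3 : ℝ)).toReal with hVE
  set K : ℝ := (eLpNormLESNormFDerivOfEqInnerConst (volume : Measure E) 2 : ℝ) with hK
  have hVE0 : 0 ≤ VE := ENNReal.toReal_nonneg
  have hK0 : 0 ≤ K := NNReal.coe_nonneg _
  have hX0 : 0 ≤ X := by
    rw [hX]; exact integral_nonneg fun x => mul_nonneg (sq_nonneg _) (frobeniusNormSq_nonneg _)
  have hw3 : MemLp (fun x => V x + e x) 3 volume := hV3.add he3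
  -- the five estimates
  have h1 := abs_transport_term_le hV3 hw3 (R := R) hC₁
  have h2 := abs_gradient_cutoff_term_le hE hV1 hV3 hR hC₁ hν.le
  obtain ⟨h3, h4⟩ := abs_coupling_cutoff_terms_le hV3 he3 (R := R) hC₁
  have h5 := abs_absorbed_term_le hE hV1 hV3 he1.continuous he3 hR hC₁ hν
  have h6 := abs_source_term_le hV1 he1.continuous he4 hR0 hν
  have hexp := remainder_coupling_expansion hV1 he1 (contDiff_cutoff_sq (n := 1) R)
    (hasCompactSupport_cutoff_sq hR0) (fun x _ => hdivV x) (fun x _ => hdive x)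
  -- the norm products
  have hp1 : (eLpNorm V 3 volume * eLpNorm V 3 volume * eLpNorm (fun x => V x + e x) 3 volume).toReal ≤ Λ ^ 3 :=
    toReal_mul_mul_le_cube hΛ hΛV hΛV hΛw
  have hp3 : (eLpNorm V 3 volume * eLpNorm e 3 volume * eLpNorm V 3 volume).toReal ≤ Λ ^ 3 :=
    toReal_mul_mul_le_cube hΛ hΛV hΛe hΛV
  have hp4 : (eLpNorm V 3 volume * eLpNorm e 3 volume * eLpNorm e 3 volume).toReal ≤ Λ ^ 3 :=
    toReal_mul_mul_le_cube hΛ hΛV hΛe hΛe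
  have hp2 : (eLpNorm V 3 volume ^ 2).toReal ≤ Λ ^ 2 := by
    rw [ENNReal.toReal_pow]
    exact pow_le_pow_left₀ ENNReal.toReal_nonneg hΛV 2
  have hpe : (eLpNorm e 3 volume).toReal ^ 2 ≤ Λ ^ 2 := pow_le_pow_left₀ ENNReal.toReal_nonneg hΛe 2
  set bd : ℝ := 2 * C₁ ^ 2 * VE / R * (eLpNorm V 3 volume ^ 2).toReal with hbd
  have hbd_le : bd ≤ 2 * C₁ ^ 2 * VE / R * Λ ^ 2 := by
    rw [hbd]; exact mul_le_mul_of_nonneg_left hp2 (by positivity)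
  -- bounds of the individual terms by `Λ`
  have e1 : |∫ x, ‖V x‖ ^ 2 * ⟪V x + e x, gradient (fun y : E => cutoff R y ^ 2) x⟫| ≤ 2 * (C₁ / R) * Λ ^ 3 :=
    h1.trans (mul_le_mul_of_nonneg_left hp1 (by positivity))
  have e3 : |2 * ∫ x, ⟪V x, e x⟫ * ⟪V x, gradient (fun y : E => cutoff R y ^ 2) x⟫| ≤ 4 * (C₁ / R) * Λ ^ 3 :=
    h3.trans (mul_le_mul_of_nonneg_left hp3 (by positivity))
  have e4 : |2 * ∫ x, ⟪V x, e x⟫ * ⟪e x, gradient (fun y : E => cutoff R y ^ 2) x⟫| ≤ 4 * (C₁ / R) * Λ ^ 3 :=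
    h4.trans (mul_le_mul_of_nonneg_left hp4 (by positivity))
  have e2 : 2 * ν * |∫ x, ⟪fderiv ℝ V x (gradient (fun y : E => cutoff R y ^ 2) x), V x⟫| ≤
      ν / 4 * X + 16 * ν * (2 * C₁ ^ 2 * VE / R * Λ ^ 2) := by
    refine h2.trans ?_
    have : 16 * ν * bd ≤ 16 * ν * (2 * C₁ ^ 2 * VE / R * Λ ^ 2) :=
      mul_le_mul_of_nonneg_left hbd_le (by positivity)
    linarith
  have e5 : 2 * |∫ x, cutoff R x ^ 2 * ⟪fderiv ℝ V x (V x), e x⟫| ≤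
      (ν / 4 + ν / 4) * X + 4 / ν * (K ^ 2 * Λ ^ 2 * (2 * (2 * C₁ ^ 2 * VE / R * Λ ^ 2))) := by
    refine h5.trans ?_
    have hA : (2 * Real.sqrt 2 * K * (eLpNorm e 3 volume).toReal + ν / 4) * X ≤ (ν / 4 + ν / 4) * X :=
      mul_le_mul_of_nonneg_right (by linarith) hX0
    have hB : K ^ 2 * (eLpNorm e 3 volume).toReal ^ 2 * (2 * bd) ≤
        K ^ 2 * Λ ^ 2 * (2 * (2 * C₁ ^ 2 * VE / R * Λ ^ 2)) := by
      have hbd0 : 0 ≤ bd := by rw [hbd]; positivity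
      gcongr
    have hB' := mul_le_mul_of_nonneg_left hB (by positivity : (0 : ℝ) ≤ 4 / ν)
    linarith
  -- absolute values to signed terms
  have s1 := (le_abs_self _).trans e1
  have s2 : -(2 * ν * ∫ x, ⟪fderiv ℝ V x (gradient (fun y : E => cutoff R y ^ 2) x), V x⟫) ≤
      ν / 4 * X + 16 * ν * (2 * C₁ ^ 2 * VE / R * Λ ^ 2) := by
    have h := neg_abs_le (∫ x, ⟪fderiv ℝ V x (gradient (fun y : E => cutoff R y ^ 2) x), V x⟫)
    have h' : -(2 * ν * ∫ x, ⟪fderiv ℝ V x (gradient (fun y : E => cutoff R y ^ 2) x), V x⟫) ≤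
        2 * ν * |∫ x, ⟪fderiv ℝ V x (gradient (fun y : E => cutoff R y ^ 2) x), V x⟫| := by
      have := mul_le_mul_of_nonneg_left h (by positivity : (0 : ℝ) ≤ 2 * ν)
      linarith
    linarith [e2]
  have s3 := (le_abs_self _).trans e3
  have s4 := (le_abs_self _).trans e4
  have s5 : 2 * ∫ x, cutoff R x ^ 2 * ⟪fderiv ℝ V x (V x), e x⟫ ≤
      (ν / 4 + ν / 4) * X + 4 / ν * (K ^ 2 * Λ ^ 2 * (2 * (2 * C₁ ^ 2 * VE / R * Λ ^ 2))) := by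
    have h := le_abs_self (∫ x, cutoff R x ^ 2 * ⟪fderiv ℝ V x (V x), e x⟫)
    linarith [e5]
  have s6 : 2 * ∫ x, cutoff R x ^ 2 * ⟪fderiv ℝ V x (e x), e x⟫ ≤
      ν / 4 * X + 4 / ν * ∫ x, ‖e x‖ ^ 4 := by
    have h := le_abs_self (∫ x, cutoff R x ^ 2 * ⟪fderiv ℝ V x (e x), e x⟫)
    linarith [h6]
  have sP : 2 * P ≤ 2 * P₀ := by linarith [le_abs_self P]
  -- the coupling term
  have hcoup : -(2 * ∫ x, cutoff R x ^ 2 * ⟪V x, fderiv ℝ e x (V x + e x)⟫) ≤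
      4 * (C₁ / R) * Λ ^ 3 + ((ν / 4 + ν / 4) * X + 4 / ν * (K ^ 2 * Λ ^ 2 * (2 * (2 * C₁ ^ 2 * VE / R * Λ ^ 2)))) +
        4 * (C₁ / R) * Λ ^ 3 + (ν / 4 * X + 4 / ν * ∫ x, ‖e x‖ ^ 4) := by
    have heq : -(2 * ∫ x, cutoff R x ^ 2 * ⟪V x, fderiv ℝ e x (V x + e x)⟫) =
        -2 * ∫ x, cutoff R x ^ 2 * ⟪V x, fderiv ℝ e x (V x + e x)⟫ := by ring
    rw [heq, hexp]
    linarith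
  -- assemble
  have hR1 : 1 / R ≤ 1 := by rw [div_le_one hR0]; exact hR
  have key : 2 * (C₁ / R) * Λ ^ 3 + 16 * ν * (2 * C₁ ^ 2 * VE / R * Λ ^ 2) +
      4 * (C₁ / R) * Λ ^ 3 + 4 / ν * (K ^ 2 * Λ ^ 2 * (2 * (2 * C₁ ^ 2 * VE / R * Λ ^ 2))) +
      4 * (C₁ / R) * Λ ^ 3 =
      (10 * C₁ * Λ ^ 3 + 32 * ν * C₁ ^ 2 * VE * Λ ^ 2 + 16 / ν * K ^ 2 * C₁ ^ 2 * VE * Λ ^ 4) / R := by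
    field_simp
    ring
  linarith [s1, s2, sP, hcoup, key]

end Slice

/-! ### The cut-off window inequality for classical data -/

section Window

variable {E : Type*} [NormedAddCommGroup E] [InnerProductSpace ℝ E] [FiniteDimensional ℝ E]
  [MeasurableSpace E] [BorelSpace E]

/-- **The cut-off window inequality** (per cutoff radius `R = n + 1`; GIP 2003, proof of Thm. 2.1,
(8) integrated in time, p. 1397). Let `(w, π)` be a classical solution on the open strip
`(0, T)`, `e` a smooth caloric (`∂ₜe = νΔe`), divergence-free field on the strip, `v = w - e`,
`0 < a ≤ b < T`; assume on `[a, b]` the `L³` bounds `Λ`, `e(τ) ∈ L⁴` with `τ ↦ ∫|e(τ)|⁴` integrable,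
the smallness `2√2 K‖e(τ)‖₃ ≤ ν/4`, and the pressure bound `|∫ π⟪v, ∇χ_R²⟫| ≤ P₀/R` for a.e.
`τ`. Then
`∫ χ_R²|v(b)|² + ν ∫_a^b ∫ χ_R²|Dv|² ≤ ∫ χ_R²|v(a)|² + (4/ν)∫_a^b∫|e|⁴ + (b - a)(Err + 2P₀)/R`.
[cite: GallagherIftimiePlanchon2003, Thm. 2.1 (proof, (8), p. 1397)] -/
theorem classical_window_inequality {ι : Type*} [Fintype ι] (bs : OrthonormalBasis ι ℝ E)
    (hE : Module.finrank ℝ E = 3) {T ν : ℝ} {w e : ℝ → E → E} {π : ℝ → E → ℝ}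
    (hcl : IsClassicalNSSolutionOn (Ioo 0 T) ν 0 w π) (hν : 0 < ν)
    (he : IsSmoothSpaceTimeOn (Ioo 0 T) e)
    (hheat : ∀ t ∈ Ioo 0 T, ∀ x, timeDeriv e t x = ν • (Δ (e t)) x)
    (hdive : ∀ t ∈ Ioo 0 T, VectorCalculus.IsDivFree (e t))
    {a b : ℝ} (ha : 0 < a) (hab : a ≤ b) (hbT : b < T) {Λ P₀ C₁ : ℝ} (hΛ : 0 ≤ Λ)
    (hv3 : ∀ τ ∈ Icc a b, MemLp (fun x => w τ x - e τ x) 3 volume ∧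
      (eLpNorm (fun x => w τ x - e τ x) 3 volume).toReal ≤ Λ)
    (he3 : ∀ τ ∈ Icc a b, MemLp (e τ) 3 volume ∧ (eLpNorm (e τ) 3 volume).toReal ≤ Λ)
    (hw3 : ∀ τ ∈ Icc a b, MemLp (w τ) 3 volume ∧ (eLpNorm (w τ) 3 volume).toReal ≤ Λ)
    (he4 : ∀ τ ∈ Icc a b, MemLp (e τ) 4 volume)
    (hE4 : IntegrableOn (fun τ => ∫ x, ‖e τ x‖ ^ 4) (Ioo a b) volume)
    (hsmall : ∀ τ ∈ Icc a b, 2 * Real.sqrt 2 *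
      (eLpNormLESNormFDerivOfEqInnerConst (volume : Measure E) 2 : ℝ) * (eLpNorm (e τ) 3 volume).toReal ≤ ν / 4)
    (hC₁ : ∀ R : ℝ, 0 < R → ∀ x : E, ‖fderiv ℝ (cutoff R) x‖ ≤ C₁ / R) {R : ℝ} (hR : 1 ≤ R)
    (hP : ∀ᵐ τ ∂((volume : Measure ℝ).restrict (Ioo a b)),
      |∫ x, π τ x * ⟪w τ x - e τ x, gradient (fun y : E => cutoff R y ^ 2) x⟫| ≤ P₀ / R) :
    (∫ x, cutoff R x ^ 2 * ‖w b x - e b x‖ ^ 2) +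
        ν * ∫ τ in Ioo a b, ∫ x, cutoff R x ^ 2 * frobeniusNormSq (fderiv ℝ (fun y => w τ y - e τ y) x) ≤
      (∫ x, cutoff R x ^ 2 * ‖w a x - e a x‖ ^ 2) + 4 / ν * (∫ τ in Ioo a b, ∫ x, ‖e τ x‖ ^ 4) +
        (b - a) * ((10 * C₁ * Λ ^ 3 +
          32 * ν * C₁ ^ 2 * ((volume (closedBall (0 : E) 1)) ^ (1 / 3 : ℝ)).toReal * Λ ^ 2 +
          16 / ν * (eLpNormLESNormFDerivOfEqInnerConst (volume : Measure E) 2 : ℝ) ^ 2 * C₁ ^ 2 *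
            ((volume (closedBall (0 : E) 1)) ^ (1 / 3 : ℝ)).toReal * Λ ^ 4) / R + 2 * (P₀ / R)) := by
  have hR0 : 0 < R := one_pos.trans_le hR
  have hI : Icc a b ⊆ Ioo 0 T := fun t ht => ⟨ha.trans_le ht.1, ht.2.trans_lt hbT⟩
  have hφ : ContDiff ℝ 2 fun y : E => cutoff R y ^ 2 := contDiff_cutoff_sq (n := 2) R
  have hφc : HasCompactSupport fun y : E => cutoff R y ^ 2 := hasCompactSupport_cutoff_sq hR0
  -- the smooth remainder `v = w - e`
  have hv : IsSmoothSpaceTimeOn (Ioo 0 T) fun t x => w t x - e t x := hcl.smooth_velocity.sub he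
  -- ### the identity
  have hid := remainder_local_energy_identity bs hcl isOpen_Ioo he hheat hdive hφ hφc hab hI
  -- the error constant
  set c : ℝ := (10 * C₁ * Λ ^ 3 +
      32 * ν * C₁ ^ 2 * ((volume (closedBall (0 : E) 1)) ^ (1 / 3 : ℝ)).toReal * Λ ^ 2 +
      16 / ν * (eLpNormLESNormFDerivOfEqInnerConst (volume : Measure E) 2 : ℝ) ^ 2 * C₁ ^ 2 *
        ((volume (closedBall (0 : E) 1)) ^ (1 / 3 : ℝ)).toReal * Λ ^ 4) / R + 2 * (P₀ / R) with hc
  -- the integrand of the identity and its a.e. bound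
  set F : ℝ → ℝ := fun τ =>
    (∫ x, ‖w τ x - e τ x‖ ^ 2 * ⟪w τ x, gradient (fun y : E => cutoff R y ^ 2) x⟫) -
      2 * ν * (∫ x, ⟪fderiv ℝ (fun y => w τ y - e τ y) x (gradient (fun y : E => cutoff R y ^ 2) x),
        w τ x - e τ x⟫) -
      2 * ν * (∫ x, (fun y : E => cutoff R y ^ 2) x * frobeniusNormSq (fderiv ℝ (fun y => w τ y - e τ y) x)) +
      2 * (∫ x, π τ x * ⟪w τ x - e τ x, gradient (fun y : E => cutoff R y ^ 2) x⟫) -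
      2 * ∫ x, (fun y : E => cutoff R y ^ 2) x * ⟪w τ x - e τ x, fderiv ℝ (e τ) x (w τ x)⟫ with hF
  set X : ℝ → ℝ := fun τ =>
    ∫ x, cutoff R x ^ 2 * frobeniusNormSq (fderiv ℝ (fun y => w τ y - e τ y) x) with hXdef
  set Maj : ℝ → ℝ := fun τ => -ν * X τ + 4 / ν * (∫ x, ‖e τ x‖ ^ 4) + c with hMaj
  have hid' : (∫ x, cutoff R x ^ 2 * ‖w b x - e b x‖ ^ 2) -
      (∫ x, cutoff R x ^ 2 * ‖w a x - e a x‖ ^ 2) = ∫ τ in Ioo a b, F τ := hid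
  -- ### the slice bound, a.e. in `τ`
  have hae : ∀ᵐ τ ∂((volume : Measure ℝ).restrict (Ioo a b)), F τ ≤ Maj τ := by
    filter_upwards [hP, ae_restrict_mem measurableSet_Ioo] with τ hPτ hτ
    have hτI : τ ∈ Icc a b := Ioo_subset_Icc_self hτ
    have hτS : τ ∈ Ioo 0 T := hI hτI
    have hV1 : ContDiff ℝ 1 fun y => w τ y - e τ y := (hv.contDiff_slice hτS).of_le (by norm_cast)
    have he1 : ContDiff ℝ 1 (e τ) := (he.contDiff_slice hτS).of_le (by norm_cast)
    have hw1 : ContDiff ℝ 1 (w τ) := (hcl.smooth_velocity.contDiff_slice hτS).of_le (by norm_cast)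
    have hwd : ∀ x : E, DifferentiableAt ℝ (w τ) x := fun x => hw1.differentiable one_ne_zero x
    have hed : ∀ x : E, DifferentiableAt ℝ (e τ) x := fun x => he1.differentiable one_ne_zero x
    have hdivV : ∀ x, VectorCalculus.divergence (fun y => w τ y - e τ y) x = 0 := by
      intro x
      have h1 : VectorCalculus.divergence (fun y => w τ y - e τ y) x =
          VectorCalculus.divergence (w τ) x - VectorCalculus.divergence (e τ) x := by
        simp only [VectorCalculus.divergence, fderiv_fun_sub (hwd x) (hed x),
          ContinuousLinearMap.toLinearMap_sub, map_sub]
      rw [h1, hcl.divFree τ hτS x, hdive τ hτS x, sub_zero]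
    have hweq : (fun x => (fun y => w τ y - e τ y) x + e τ x) = w τ := by
      funext x; simp only [sub_add_cancel]
    have hΛw : (eLpNorm (fun x => (fun y => w τ y - e τ y) x + e τ x) 3 volume).toReal ≤ Λ := by
      rw [hweq]; exact (hw3 τ hτI).2
    have hs := slice_rhs_le hE hV1 (hv3 τ hτI).1 he1 (he3 τ hτI).1 (he4 τ hτI) hdivV
      (fun x => hdive τ hτS x) hR (hC₁ R hR0) hν hΛ (hv3 τ hτI).2 (he3 τ hτI).2 hΛw (hsmall τ hτI) hPτ
    simp only [sub_add_cancel] at hs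
    show F τ ≤ Maj τ
    simp only [hF, hMaj, hXdef, hc]
    linarith [hs]
  -- ### integrability of `F` on the window: `F τ = ∫ 2φ ⟪v, ∂ₜv⟫`
  set D : ℝ × E → ℝ := fun z => 2 * (cutoff R z.2 ^ 2) *
    ⟪w z.1 z.2 - e z.1 z.2, timeDeriv (fun t x => w t x - e t x) z.1 z.2⟫ with hD
  have hv_cont : ContinuousOn (uncurry fun t x => w t x - e t x) (Ioo 0 T ×ˢ univ) := hv.continuousOn
  have hdt : IsSmoothSpaceTimeOn (Ioo 0 T) (timeDeriv fun t x => w t x - e t x) := by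
    have h := hv.timeDerivWithin isOpen_Ioo.uniqueDiffOn
    refine h.congr fun z hz => ?_
    obtain ⟨τ, x⟩ := z
    simp only [uncurry_apply_pair, timeDeriv_apply]
    exact (timeDerivWithin_eq_deriv isOpen_Ioo hz.1 (fun t x => w t x - e t x) x).symm
  have hDcont : ContinuousOn D (Icc a b ×ˢ univ) := by
    have hsub : Icc a b ×ˢ (univ : Set E) ⊆ Ioo 0 T ×ˢ univ := prod_mono hI Subset.rfl
    refine (continuousOn_const.mul ((contDiff_cutoff (n := 1) R).continuous.pow 2
      |>.comp continuous_snd).continuousOn).mul ?_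
    exact (hv_cont.mono hsub).inner (hdt.continuousOn.mono hsub)
  have hDK : ∀ τ ∈ Icc a b, ∀ x ∉ tsupport (cutoff (E := E) R), D (τ, x) = 0 := by
    intro τ _ x hx
    simp only [hD, image_eq_zero_of_notMem_tsupport hx, zero_pow two_ne_zero, mul_zero, zero_mul]
  have hDint := integrable_prod_of_continuousOn (hasCompactSupport_cutoff hR0) hDcont hDK
  have hGint : Integrable (fun τ => ∫ x, D (τ, x)) ((volume : Measure ℝ).restrict (Ioo a b)) :=
    hDint.integral_prod_left
  have hFG : ∀ τ ∈ Ioo a b, F τ = ∫ x, D (τ, x) := by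
    intro τ hτ
    have hτS : τ ∈ Ioo 0 T := hI (Ioo_subset_Icc_self hτ)
    have hdτ : ∀ x, timeDeriv (fun t x => w t x - e t x) τ x = timeDeriv w τ x - timeDeriv e τ x := by
      intro x
      simp only [timeDeriv_apply]
      exact ((hcl.smooth_velocity.hasDerivAt_timeLine isOpen_Ioo hτS x).sub
        (he.hasDerivAt_timeLine isOpen_Ioo hτS x)).deriv
    have hm : ∀ x, timeDeriv w τ x + convect (w τ) (w τ) x = ν • (Δ (w τ)) x - gradient (π τ) x := by
      intro x
      have h := hcl.momentum τ hτS x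
      rw [timeDerivWithin_eq_deriv isOpen_Ioo hτS] at h
      rw [timeDeriv_apply, h, Pi.zero_apply, Pi.zero_apply, add_zero]
    have hslice := remainder_slice_identity bs
      ((hcl.smooth_velocity.contDiff_slice hτS).of_le (by norm_cast))
      ((he.contDiff_slice hτS).of_le (by norm_cast))
      ((hcl.smooth_pressure.contDiff_slice hτS).of_le (by norm_cast)) hφ hφc
      (fun x _ => hm x) (fun x _ => hheat τ hτS x) (fun x _ => hcl.divFree τ hτS x)
      (fun x _ => hdive τ hτS x)
    simp only [hD, hdτ]
    rw [hslice]
  have hFint : Integrable F ((volume : Measure ℝ).restrict (Ioo a b)) :=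
    hGint.congr ((ae_restrict_mem measurableSet_Ioo).mono fun τ hτ => (hFG τ hτ).symm)
  -- ### integrability of the majorant: `X` is continuous on `[a, b]`
  have hXcont : ContinuousOn X (Icc a b) := by
    have hsub : Icc a b ×ˢ (univ : Set E) ⊆ Ioo 0 T ×ˢ univ := prod_mono hI Subset.rfl
    have hG : ContinuousOn (fun z : ℝ × E => frobeniusNormSq (fderiv ℝ (fun y => w z.1 y - e z.1 y) z.2))
        (Icc a b ×ˢ univ) := by
      have h1 := (hv.fderiv_slice isOpen_Ioo.uniqueDiffOn).continuousOn.mono hsub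
      have hfrob : Continuous fun L : E →L[ℝ] E => frobeniusNormSq L := by
        have : (fun L : E →L[ℝ] E => frobeniusNormSq L) = fun L => ∑ i, ‖L (bs i)‖ ^ 2 :=
          funext fun L => frobeniusNormSq_eq_sum bs L
        rw [this]
        exact continuous_finsetSum _ fun i _ => ((ContinuousLinearMap.apply ℝ E (bs i)).continuous.norm).pow 2
      exact hfrob.comp_continuousOn h1
    exact continuousOn_integral_mul_of_continuousOn ((contDiff_cutoff (n := 1) R).continuous.pow 2)
      (hasCompactSupport_cutoff_sq hR0) hG
  have hXint : IntegrableOn X (Ioo a b) volume :=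
    (hXcont.integrableOn_compact isCompact_Icc).mono_set Ioo_subset_Icc_self
  have hMint : Integrable Maj ((volume : Measure ℝ).restrict (Ioo a b)) := by
    have h1 : IntegrableOn (fun τ => -ν * X τ) (Ioo a b) volume := hXint.const_mul _
    have h2 : IntegrableOn (fun τ => 4 / ν * ∫ x, ‖e τ x‖ ^ 4) (Ioo a b) volume := hE4.const_mul _
    have h3 : IntegrableOn (fun _ : ℝ => c) (Ioo a b) volume := integrableOn_const measure_Ioo_lt_top.ne
    exact (h1.add h2).add h3
  -- ### integrate
  have hint : ∫ τ in Ioo a b, F τ ≤ ∫ τ in Ioo a b, Maj τ := integral_mono_ae hFint hMint hae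
  have hMaj_eval : ∫ τ in Ioo a b, Maj τ =
      -ν * (∫ τ in Ioo a b, X τ) + 4 / ν * (∫ τ in Ioo a b, ∫ x, ‖e τ x‖ ^ 4) + (b - a) * c := by
    have h1 : IntegrableOn (fun τ => -ν * X τ) (Ioo a b) volume := hXint.const_mul _
    have h2 : IntegrableOn (fun τ => 4 / ν * ∫ x, ‖e τ x‖ ^ 4) (Ioo a b) volume := hE4.const_mul _
    have h3 : IntegrableOn (fun _ : ℝ => c) (Ioo a b) volume := integrableOn_const measure_Ioo_lt_top.ne
    have h12 : IntegrableOn (fun τ => -ν * X τ + 4 / ν * ∫ x, ‖e τ x‖ ^ 4) (Ioo a b) volume := h1.add h2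
    simp only [hMaj]
    rw [integral_add h12 h3, integral_add h1 h2, integral_const_mul, integral_const_mul,
      setIntegral_const, Real.volume_real_Ioo_of_le hab, smul_eq_mul, mul_comm (b - a) c]
  rw [hMaj_eval] at hint
  linarith [hid', hint]

end Window

end GIP2003

end Literature.Analysis.FluidPDE

end
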